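import Literature.NumberTheory.EllipticCurves.NewformSymmSquareJ0Hecke
import HarnessLib

/-!
# Stub `stub_j0` of the crux skeleton `DefiniteXi.PeterssonLowerBound` (stmt-ABC-10870), line Sketch:
# `L(1, Sym² f) ≫_ε N^{-ε}` on the CM family `j = 0`

The stub is exactly the tree's `exists_symmSqLOne_ge_of_j_eq_zero` (`NewformSymmSquareJ0Hecke`, proved:
`L_f(σ) = L(σ, χ₋₃) · L(σ, ν_W) · E(σ)` for the Grössencharakter `ν_W = ν_{d_W,1,2}` of `ℚ(ζ₃)`, `σ → 1⁺`,
and the zero-free region of the Hecke `L`-functions of `ℚ(ζ₃)` without exceptional zero). An independent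
proof of the same statement along the same lines, by this line's helpers
`…DefiniteXiPeterssonLowerBoundStubJ0{Euler,PrimePow,Values,Correction,Data}` (accepted), is kept in the
session folder (`work/stubs/stub_j0_flat_bounced.bak`, p102715, bounced as a duplicate of the Literature
theorem once the latter landed).

[cite: HoffsteinLockhart1994, Thm. 0.1 (the CM case)]
-/

noncomputable section

open scoped Real Topology
open Set Filter Metric Complex CongruenceSubgroup
open Literature.NumberTheory.EllipticCurves.ModularForms
open Literature.NumberTheory.LFunctions

set_option linter.dupNamespace false

namespace Summit.ABC.ABC.Theorems

/-- **`L(1, Sym² f) ≫ N^{-ε}` on the family `j = 0`** (`y² = x³ + D`, CM by `ℤ[ζ₃]`): the shape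
`hCM0` of `murty_petersson_newform_lower_bound_of_pairData_nonCM_of_j_zero`; Hecke `L`-functions
of `ℚ(√-3)` with Grössencharakter of frequency `2` and `4`, zero-free region without exceptional
zero (the tree's `exists_symmSqLOne_ge_of_j_eq_zero`). [cite: HoffsteinLockhart1994, Thm. 0.1 (the CM case)] -/
theorem stub_j0 : ∀ ε : ℝ, 0 < ε → ∃ c : ℝ, 0 < c ∧
    ∀ j : EllipticNewformIndex, j.W.j = 0 → c * (j.N : ℝ) ^ (-ε) ≤ symmSqLOne j.f :=
  fun _ hε ↦ exists_symmSqLOne_ge_of_j_eq_zero hε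

end Summit.ABC.ABC.Theorems

end
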